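import Mathlib
import Literature.NumberTheory.LFunctions.Zhang2022.TypedSection17NuStarBound
import Literature.NumberTheory.LFunctions.Zhang2022.TypedSection15A
import Literature.NumberTheory.LFunctions.Zhang2022.Section15Bcoef
import HarnessLib

/-!
# Zhang (2022) §17 p. 98: the splitting identities `Z22:§17.u019` and `Z22:§17.u020`, generic form,
# with the literal instances kernel-checked

Topic `Literature/NumberTheory/LFunctions/Zhang2022` (Landau–Siegel audit tree; verdict-neutral).
Y. Zhang, *Discrete mean estimates and the Landau–Siegel zero*, arXiv:2211.02515v1 (2022)
[Zhang2022LandauSiegel] — **an unrefereed manuscript under adjudication; nothing here asserts or denies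
its Theorems 1–2.** Lane ZHANG-L, work package WP16, helper under the leaf `Typed.Section17.Eq17_9Rel`
(the `I₄⁻` chain of §17, owner zl-w16-p3; WP16-PLAN §1.6).

§17 p. 98 (tex L4817–L4823), after (17.8):

> We have `Σ_n (b∗ν₁*)(n)ϱ*(n)/n = Σ_{l<D⁴} (ν(l)/l) Σ_m (b∗ν₁*)(lm)κ̄₂(m)/m` [u019]. The inner sum is
> equal to `Σ_{l=l₁l₂} Σ_{m₁} Σ_{(m₂,l₁)=1} b(l₁m₁)ν₁*(l₂m₂)κ̄₂(m₁m₂)/(m₁m₂)` [u020]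

(`ϱ*(n) = Σ_{n=lm, l<D⁴} ν(l)κ̄₂(m)`, `Typed.Section17.varrho17`). Both displays are EXACT rearrangements
of finitely supported sums; they hold for ANY coefficient sequence in place of `b` — in particular for the
printed `b` (the literal typed nodes `Typed.Section17.Step17_u019/Step17_u020`, which take `b∗ν₁*` =
`Typed.Section17.bConvNuOne`) and for the χ-twisted coefficient `(bχ)∗ν₁*` of the WP-internal re-type
RT16-int-1 (zl-w16-plan 2026-08-26T23:24Z, referee zl-w16-ref-2 F17-χ: `B(s,ψ) = Σ b(n)ψχ(n)n^{−s}`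
by (15.1), so the honest `ψ`-coefficients of `B·G·N·N` are `(bχ)∗ν₁*`; the χ-twisted displays are the
ones the leaf's chain consumes, cf. the hypothesis `h21` of the planner's `step17_u024ChiRel_of_lemma151Chi`).

PROVED here (theorems only; no definition, no named fact):

* GENERIC (§1): for sequences `f, g : ℕ → ℂ` vanishing from some index on and arbitrary `h, u : ℕ → ℂ`,
  - `tsum_sum_divisorsAntidiagonal_eq_tsum_tsum` — the fibre identity
    `Σ'_n Σ_{q₁q₂=n} G(q) = Σ'_{q₁} Σ'_{q₂} G(q₁,q₂)` for a summable `G` vanishing on the axes;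
  - `tsum_mul_convolution_indicator_div_eq_sum` — u019's shape:
    `Σ'_n a(n)·((u·𝟙_{<K})∗h)(n)/n = Σ_{1≤l<K} u(l)/l · Σ'_m a(lm)h(m)/m` (`a` finitely supported);
  - `tsum_convolution_mul_div_eq_sum_divisorsAntidiagonal` — u020's shape: for `l ≥ 1`,
    `Σ'_m (f∗g)(lm)h(m)/m = Σ_{l=l₁l₂} Σ'_{m₁} Σ'_{m₂,(m₂,l₁)=1} f(l₁m₁)g(l₂m₂)h(m₁m₂)/(m₁m₂)`, the
    divisor-pair bijection `l₂ = (e,l)` behind it being the tree's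
    `Typed.Section15A.sum_divisorsAntidiagonal_mul_regroup` ((7.17) pattern);
* INSTANCES (§2), for every modulus with `𝓛 = log D ≥ 3` (finite support of `b`, `Skeleton.bcoef_eq_zero_of_le`,
  and of `ν₁*`, `nuOneStar_eq_zero_of_le`; `exists_common_support` also records the support of `bχ`):
  the literal nodes BY NAME `step17_u019_holds : Step17_u019 c′ χ`, `step17_u020_holds : Step17_u020 c′ χ`
  (exact identities, true as typed although the leaf's chain consumes the χ-twisted twins — those are
  one-line instances of the §1 theorems with `f = bχ`, filed by zl-libA-typer in
  `Section17InnerChiIdentities.lean` per the lane's division of labour, zl-lib-2 2026-08-26T23:57Z).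

What is NOT here: the χ-twisted instances u015χ/u019χ/u020χ (sibling file), u021 (dropping `m₂ > 1`
and `(m₁,𝔮) > 1`, an estimate), (17.8), u023/u024, or any claim about Theorems 1–2 of the source.

## References

* Y. Zhang, arXiv:2211.02515v1 (2022), §17 p. 98 (tex L4817–L4823); §7 (7.17) p. 39 (the regrouping
  pattern); (15.1) p. 79. [cite: Zhang2022LandauSiegel, §17 p.98]
-/

noncomputable section

open Complex Real ComplexConjugate Filter
open scoped Topology

namespace Literature.NumberTheory.LFunctions.Zhang2022.Typed.Section17

open Literature.NumberTheory.LFunctions.Zhang2022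
open Literature.NumberTheory.LFunctions.Zhang2022.Skeleton

/-! ## §1 Generic rearrangements of finitely supported Dirichlet-convolution sums -/

section Generic

/-- The fibres of `(q₁,q₂) ↦ q₁q₂`: a summable double series vanishing on the axes sums, grouped by
the product, to its total (`HasSum.tsum_fiberwise`; the fibre over `n ≥ 1` is `n.divisorsAntidiagonal`,
the fibre over `0` carries only zero terms). (Adapted from the private copies in `Section16Eq164Mellin`
/ `TypedSection15AIdentities`.) [folklore] -/
private theorem hasSum_sum_divisorsAntidiagonal_of_summable {G : ℕ × ℕ → ℂ} (hG : Summable G)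
    (h0 : ∀ q : ℕ × ℕ, q.1 = 0 ∨ q.2 = 0 → G q = 0) :
    HasSum (fun n : ℕ => ∑ q ∈ n.divisorsAntidiagonal, G q) (∑' q : ℕ × ℕ, G q) := by
  have h := hG.hasSum.tsum_fiberwise (fun q : ℕ × ℕ => q.1 * q.2)
  have heq : (fun n : ℕ => ∑ q ∈ n.divisorsAntidiagonal, G q) =
      fun n : ℕ => ∑' b : ((fun q : ℕ × ℕ => q.1 * q.2) ⁻¹' {n}), G b.val := by
    funext n
    rcases eq_or_ne n 0 with rfl | hn
    · rw [Nat.divisorsAntidiagonal_zero, Finset.sum_empty]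
      have hz : ∀ b : ((fun q : ℕ × ℕ => q.1 * q.2) ⁻¹' {0}), G b.val = 0 := by
        rintro ⟨⟨a, c⟩, hb⟩
        simp only [Set.mem_preimage, Set.mem_singleton_iff, Nat.mul_eq_zero] at hb
        exact h0 (a, c) hb
      symm
      calc ∑' b : ((fun q : ℕ × ℕ => q.1 * q.2) ⁻¹' {0}), G b.val
          = ∑' _ : ((fun q : ℕ × ℕ => q.1 * q.2) ⁻¹' {0}), (0 : ℂ) := tsum_congr hz
        _ = 0 := tsum_zero
    · rw [show ((fun q : ℕ × ℕ => q.1 * q.2) ⁻¹' {n}) = ↑(n.divisorsAntidiagonal) by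
          ext q; simp [hn], Finset.tsum_subtype']
  rw [heq]
  exact h

/-- **Fibre identity.** For a summable `G : ℕ × ℕ → ℂ` vanishing on the axes and with summable rows,
`Σ'_n Σ_{q₁q₂ = n} G(q) = Σ'_{q₁} Σ'_{q₂} G(q₁,q₂)` — the bookkeeping behind the §17 p. 98 rearrangements
(and the (7.17) pattern). [cite: Zhang2022LandauSiegel, §17 p.98] -/
theorem tsum_sum_divisorsAntidiagonal_eq_tsum_tsum {G : ℕ × ℕ → ℂ} (hG : Summable G)
    (h0 : ∀ q : ℕ × ℕ, q.1 = 0 ∨ q.2 = 0 → G q = 0) (h1 : ∀ a : ℕ, Summable fun b : ℕ => G (a, b)) :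
    ∑' n : ℕ, ∑ q ∈ n.divisorsAntidiagonal, G q = ∑' a : ℕ, ∑' b : ℕ, G (a, b) := by
  rw [(hasSum_sum_divisorsAntidiagonal_of_summable hG h0).tsum_eq]
  exact hG.tsum_prod' h1

/-- A function on `ℕ × ℕ` supported in a finite square is summable (the finite-support bookkeeping of
the §17 p. 98 rearrangements). [cite: Zhang2022LandauSiegel, §17 p.98] -/
theorem summable_of_support_subset_square {G : ℕ × ℕ → ℂ} (N : ℕ)
    (hG : ∀ q : ℕ × ℕ, N ≤ q.1 ∨ N ≤ q.2 → G q = 0) : Summable G := by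
  refine summable_of_ne_finset_zero (s := Finset.range N ×ˢ Finset.range N) fun q hq => ?_
  refine hG q ?_
  by_contra h
  push Not at h
  exact hq (Finset.mem_product.mpr ⟨Finset.mem_range.mpr h.1, Finset.mem_range.mpr h.2⟩)

/-- A Dirichlet convolution of two sequences vanishing from `A` resp. `B` on vanishes from `A·B` on
(the support remark "`(b∗ν₁*)(n)` is supported on `n < PT⁻²`", §17 p. 98, in generic form).
[cite: Zhang2022LandauSiegel, §17 p.98] -/
theorem convolution_eq_zero_of_le {f g : ℕ → ℂ} {A B : ℕ} (hf : ∀ n, A ≤ n → f n = 0)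
    (hg : ∀ n, B ≤ n → g n = 0) {n : ℕ} (hn : A * B ≤ n) : LSeries.convolution f g n = 0 := by
  rw [LSeries.convolution_def]
  refine Finset.sum_eq_zero fun p hp => ?_
  obtain ⟨hpn, -⟩ := Nat.mem_divisorsAntidiagonal.mp hp
  by_cases h1 : A ≤ p.1
  · rw [hf _ h1, zero_mul]
  · by_cases h2 : B ≤ p.2
    · rw [hg _ h2, mul_zero]
    · exfalso
      push Not at h1 h2
      have : p.1 * p.2 < A * B := Nat.mul_lt_mul'' h1 h2
      omega

/-- A divisor-antidiagonal sum is invariant under swapping the two coordinates (used to pass between the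
two orientations `(m₁,l₂) = 1` / `(m₂,l₁) = 1` of the §17 p. 98 re-indexing). [cite: Zhang2022LandauSiegel, §17 p.98] -/
theorem sum_divisorsAntidiagonal_swap (F : ℕ × ℕ → ℂ) (n : ℕ) :
    ∑ x ∈ n.divisorsAntidiagonal, F x = ∑ x ∈ n.divisorsAntidiagonal, F x.swap :=
  Finset.sum_nbij' Prod.swap Prod.swap (fun x hx => Nat.swap_mem_divisorsAntidiagonal.mpr hx)
    (fun x hx => Nat.swap_mem_divisorsAntidiagonal.mpr hx) (fun _ _ => rfl) (fun _ _ => rfl)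
    (fun x _ => by simp)

/-- **The shape of `Z22:§17.u019`, generic**: for `a : ℕ → ℂ` vanishing from some index on and
arbitrary `u, h : ℕ → ℂ`, `K : ℕ`,
`Σ'_n a(n)·((u·𝟙_{l<K}) ∗ h)(n)/n = Σ_{1 ≤ l < K} u(l)/l · Σ'_m a(lm)h(m)/m` (both sides finite sums in
disguise). [cite: Zhang2022LandauSiegel, §17 p.98] -/
theorem tsum_mul_convolution_indicator_div_eq_sum (a u h : ℕ → ℂ) (K : ℕ) {M : ℕ}
    (ha : ∀ n, M ≤ n → a n = 0) :
    ∑' n : ℕ, a n * LSeries.convolution (fun l => if l < K then u l else 0) h n / (n : ℂ) =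
      ∑ l ∈ Finset.Ico 1 K, u l / (l : ℂ) * ∑' m : ℕ, a (l * m) * h m / (m : ℂ) := by
  -- the double series
  set G : ℕ × ℕ → ℂ := fun q =>
    a (q.1 * q.2) * ((if q.1 < K then u q.1 else 0) * h q.2) / ((q.1 : ℂ) * (q.2 : ℂ)) with hG
  have hG0 : ∀ q : ℕ × ℕ, q.1 = 0 ∨ q.2 = 0 → G q = 0 := by
    rintro ⟨q1, q2⟩ (h | h) <;> simp only at h <;> subst h <;> simp [hG]
  have hGsupp : ∀ q : ℕ × ℕ, M ≤ q.1 ∨ M ≤ q.2 → G q = 0 := by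
    rintro ⟨q1, q2⟩ hq
    rcases Nat.eq_zero_or_pos q1 with rfl | h1
    · exact hG0 _ (Or.inl rfl)
    rcases Nat.eq_zero_or_pos q2 with rfl | h2
    · exact hG0 _ (Or.inr rfl)
    have hM : M ≤ q1 * q2 := by
      rcases hq with hq | hq
      · exact le_trans hq (Nat.le_mul_of_pos_right q1 h2)
      · exact le_trans hq (Nat.le_mul_of_pos_left q2 h1)
    simp only [hG, ha _ hM, zero_mul, zero_div]
  have hGs : Summable G := summable_of_support_subset_square M hGsupp
  have hG1 : ∀ l : ℕ, Summable fun m : ℕ => G (l, m) := fun l =>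
    summable_of_ne_finset_zero (s := Finset.range M) fun m hm => by
      rw [Finset.mem_range, not_lt] at hm
      exact hGsupp (l, m) (Or.inr hm)
  -- termwise
  have hterm : ∀ n : ℕ, a n * LSeries.convolution (fun l => if l < K then u l else 0) h n / (n : ℂ) =
      ∑ q ∈ n.divisorsAntidiagonal, G q := by
    intro n
    rw [LSeries.convolution_def, Finset.mul_sum, Finset.sum_div]
    refine Finset.sum_congr rfl fun q hq => ?_
    obtain ⟨hqn, -⟩ := Nat.mem_divisorsAntidiagonal.mp hq
    simp only [hG]
    rw [← hqn, Nat.cast_mul]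
  -- the rows
  have hrow : ∀ l : ℕ, ∑' m : ℕ, G (l, m) = (if l < K then u l else 0) / (l : ℂ) *
      ∑' m : ℕ, a (l * m) * h m / (m : ℂ) := by
    intro l
    rw [← tsum_mul_left]
    refine tsum_congr fun m => ?_
    simp only [hG]
    rw [mul_div_assoc, mul_div_assoc, div_mul_div_comm]
    ring
  calc ∑' n : ℕ, a n * LSeries.convolution (fun l => if l < K then u l else 0) h n / (n : ℂ)
      = ∑' n : ℕ, ∑ q ∈ n.divisorsAntidiagonal, G q := tsum_congr hterm
    _ = ∑' l : ℕ, ∑' m : ℕ, G (l, m) := tsum_sum_divisorsAntidiagonal_eq_tsum_tsum hGs hG0 hG1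
    _ = ∑ l ∈ Finset.Ico 1 K, ∑' m : ℕ, G (l, m) := by
        refine tsum_eq_sum fun l hl => ?_
        rw [Finset.mem_Ico, not_and_or, not_le, Nat.lt_one_iff, not_lt] at hl
        rcases hl with rfl | hl
        · exact (tsum_congr fun m => hG0 (0, m) (Or.inl rfl)).trans tsum_zero
        · rw [hrow, if_neg (not_lt.mpr hl), zero_div, zero_mul]
    _ = ∑ l ∈ Finset.Ico 1 K, u l / (l : ℂ) * ∑' m : ℕ, a (l * m) * h m / (m : ℂ) := by
        refine Finset.sum_congr rfl fun l hl => ?_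
        rw [hrow, if_pos (Finset.mem_Ico.mp hl).2]

/-- **The shape of `Z22:§17.u020`, generic**: for `f, g : ℕ → ℂ` vanishing from some index on, any
`h : ℕ → ℂ` and `l ≥ 1`,
`Σ'_m (f∗g)(lm)h(m)/m = Σ_{l=l₁l₂} Σ'_{m₁} Σ'_{m₂, (m₂,l₁)=1} f(l₁m₁)g(l₂m₂)h(m₁m₂)/(m₁m₂)` — the divisor
pairs `(d,e)` of `lm` correspond to `d = l₁m₁`, `e = l₂m₂` with `l₂ = (e,l)`, `(m₂,l₁) = 1`
(`Typed.Section15A.sum_divisorsAntidiagonal_mul_regroup`, the (7.17) pattern). [cite: Zhang2022LandauSiegel, §17 p.98] -/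
theorem tsum_convolution_mul_div_eq_sum_divisorsAntidiagonal (f g h : ℕ → ℂ) {N : ℕ}
    (hf : ∀ n, N ≤ n → f n = 0) (hg : ∀ n, N ≤ n → g n = 0) {l : ℕ} (hl : 0 < l) :
    ∑' m : ℕ, LSeries.convolution f g (l * m) * h m / (m : ℂ) =
      ∑ q ∈ l.divisorsAntidiagonal, ∑' m₁ : ℕ, ∑' m₂ : ℕ,
        if Nat.Coprime m₂ q.1 then
          f (q.1 * m₁) * g (q.2 * m₂) * h (m₁ * m₂) / ((m₁ : ℂ) * m₂)
        else 0 := by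
  -- the double series attached to a factorisation `l = q.1 · q.2`
  set G : ℕ × ℕ → ℕ × ℕ → ℂ := fun q mm =>
    if Nat.Coprime mm.2 q.1 then
      f (q.1 * mm.1) * g (q.2 * mm.2) * h (mm.1 * mm.2) / ((mm.1 : ℂ) * mm.2)
    else 0 with hG
  have hG0 : ∀ q (mm : ℕ × ℕ), mm.1 = 0 ∨ mm.2 = 0 → G q mm = 0 := by
    rintro q ⟨m1, m2⟩ (h | h) <;> simp only at h <;> subst h <;> simp [hG]
  have hGsupp : ∀ q ∈ l.divisorsAntidiagonal, ∀ mm : ℕ × ℕ, N ≤ mm.1 ∨ N ≤ mm.2 → G q mm = 0 := by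
    rintro q hq ⟨m1, m2⟩ hmm
    obtain ⟨hql, hl0⟩ := Nat.mem_divisorsAntidiagonal.mp hq
    have hq1 : 0 < q.1 := Nat.pos_of_ne_zero fun h => hl0 (by rw [← hql, h, zero_mul])
    have hq2 : 0 < q.2 := Nat.pos_of_ne_zero fun h => hl0 (by rw [← hql, h, mul_zero])
    simp only [hG]
    split_ifs
    · rcases hmm with hmm | hmm
      · rw [hf _ (le_trans hmm (Nat.le_mul_of_pos_left m1 hq1))]; simp
      · rw [hg _ (le_trans hmm (Nat.le_mul_of_pos_left m2 hq2))]; simp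
    · rfl
  have hGs : ∀ q ∈ l.divisorsAntidiagonal, Summable (G q) := fun q hq =>
    summable_of_support_subset_square N (hGsupp q hq)
  have hG1 : ∀ q ∈ l.divisorsAntidiagonal, ∀ m₁ : ℕ, Summable fun m₂ : ℕ => G q (m₁, m₂) :=
    fun q hq m₁ => summable_of_ne_finset_zero (s := Finset.range N) fun m₂ hm => by
      rw [Finset.mem_range, not_lt] at hm
      exact hGsupp q hq (m₁, m₂) (Or.inr hm)
  -- termwise: the regrouping of the convolution at `l·m`
  have hterm : ∀ m : ℕ, LSeries.convolution f g (l * m) * h m / (m : ℂ) =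
      ∑ q ∈ l.divisorsAntidiagonal, ∑ mm ∈ m.divisorsAntidiagonal, G q mm := by
    intro m
    rcases Nat.eq_zero_or_pos m with rfl | hm
    · simp [Nat.divisorsAntidiagonal_zero]
    rw [LSeries.convolution_def]
    simp only
    rw [sum_divisorsAntidiagonal_swap (fun x => f x.1 * g x.2) (l * m)]
    simp only [Prod.fst_swap, Prod.snd_swap]
    have hre : ∑ x ∈ (l * m).divisorsAntidiagonal, f x.2 * g x.1 =
        ∑ x ∈ (l * m).divisorsAntidiagonal, g x.1 * f x.2 :=
      Finset.sum_congr rfl fun x _ => mul_comm _ _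
    rw [hre, Typed.Section15A.sum_divisorsAntidiagonal_mul_regroup g f hl hm, Finset.sum_mul,
      Finset.sum_div]
    -- swap the outer pair `dd ↦ dd.swap` and the inner pair `ll ↦ ll.swap`
    rw [sum_divisorsAntidiagonal_swap]
    refine Finset.sum_congr rfl fun q hq => ?_
    simp only [Prod.fst_swap, Prod.snd_swap]
    rw [Finset.sum_mul, Finset.sum_div, Finset.sum_filter, sum_divisorsAntidiagonal_swap]
    refine Finset.sum_congr rfl fun mm hmm => ?_
    obtain ⟨hmmm, -⟩ := Nat.mem_divisorsAntidiagonal.mp hmm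
    simp only [Prod.fst_swap, Prod.snd_swap, hG]
    split_ifs with hc
    · rw [← hmmm]
      push_cast
      ring
    · simp
  -- assemble
  have hsumm : ∀ q ∈ l.divisorsAntidiagonal,
      Summable fun m : ℕ => ∑ mm ∈ m.divisorsAntidiagonal, G q mm := fun q hq =>
    (hasSum_sum_divisorsAntidiagonal_of_summable (hGs q hq) (hG0 q)).summable
  calc ∑' m : ℕ, LSeries.convolution f g (l * m) * h m / (m : ℂ)
      = ∑' m : ℕ, ∑ q ∈ l.divisorsAntidiagonal, ∑ mm ∈ m.divisorsAntidiagonal, G q mm :=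
        tsum_congr hterm
    _ = ∑ q ∈ l.divisorsAntidiagonal, ∑' m : ℕ, ∑ mm ∈ m.divisorsAntidiagonal, G q mm :=
        Summable.tsum_finsetSum hsumm
    _ = ∑ q ∈ l.divisorsAntidiagonal, ∑' m₁ : ℕ, ∑' m₂ : ℕ, G q (m₁, m₂) :=
        Finset.sum_congr rfl fun q hq =>
          tsum_sum_divisorsAntidiagonal_eq_tsum_tsum (hGs q hq) (hG0 q) (hG1 q hq)

end Generic

/-! ## §2 The §17 instances at the literal coefficient `b∗ν₁*` (nodes u019/u020 BY NAME) -/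

section Instances

variable (c' : ℝ) {D : ℕ} (χ : DirichletCharacter ℂ D)

/-- `b(n) = 0` for `n ≥ ⌈P/T²⌉₊` (`𝓛 ≥ 3`; (15.2), `Skeleton.bcoef_eq_zero_of_le`).
[cite: Zhang2022LandauSiegel, §15 (15.2) p.79] -/
theorem bcoef_eq_zero_of_ceil_le (hD : 3 ≤ ell D) {n : ℕ} (hn : ⌈bigP D / bigT D ^ 2⌉₊ ≤ n) :
    bcoef D n = 0 :=
  Skeleton.bcoef_eq_zero_of_le hD (le_trans (Nat.le_ceil _) (by exact_mod_cast hn))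

/-- `(bχ)(n) = 0` for `n ≥ ⌈P/T²⌉₊` (`𝓛 ≥ 3`). [cite: Zhang2022LandauSiegel, §15 (15.2) p.79] -/
theorem bcoef_mul_chi_eq_zero_of_ceil_le (hD : 3 ≤ ell D) {n : ℕ} (hn : ⌈bigP D / bigT D ^ 2⌉₊ ≤ n) :
    bcoef D n * χ (n : ZMod D) = 0 := by
  rw [bcoef_eq_zero_of_ceil_le hD hn, zero_mul]

/-- `ν₁*(n) = 0` for `n ≥ ⌈4(D⁴+1)T⁴⌉₊` (`nuOneStar_eq_zero_of_le`). [cite: Zhang2022LandauSiegel, §17 u021 p.98] -/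
theorem nuOneStar_eq_zero_of_ceil_le {n : ℕ} (hn : ⌈4 * ((D : ℝ) ^ 4 + 1) * bigT D ^ 4⌉₊ ≤ n) :
    nuOneStar c' χ n = 0 :=
  nuOneStar_eq_zero_of_le c' χ (le_trans (Nat.le_ceil _) (by exact_mod_cast hn))

/-- A common index beyond which `b`, `bχ` and `ν₁*` all vanish (`𝓛 ≥ 3`). [cite: Zhang2022LandauSiegel, §17 p.98] -/
theorem exists_common_support (hD : 3 ≤ ell D) : ∃ N : ℕ,
    (∀ n, N ≤ n → bcoef D n = 0) ∧ (∀ n, N ≤ n → bcoef D n * χ (n : ZMod D) = 0) ∧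
      ∀ n, N ≤ n → nuOneStar c' χ n = 0 := by
  refine ⟨max ⌈bigP D / bigT D ^ 2⌉₊ ⌈4 * ((D : ℝ) ^ 4 + 1) * bigT D ^ 4⌉₊, fun n hn => ?_,
    fun n hn => ?_, fun n hn => ?_⟩
  · exact bcoef_eq_zero_of_ceil_le hD (le_trans (le_max_left _ _) hn)
  · exact bcoef_mul_chi_eq_zero_of_ceil_le χ hD (le_trans (le_max_left _ _) hn)
  · exact nuOneStar_eq_zero_of_ceil_le c' χ (le_trans (le_max_right _ _) hn)


/-- **`Z22:§17.u019` (literal) holds** for every modulus with `𝓛 ≥ 3`: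
`Σ_n (b∗ν₁*)(n)ϱ*(n)/n = Σ_{l<D⁴} (ν(l)/l) Σ_m (b∗ν₁*)(lm)κ̄₂(m)/m` — an exact rearrangement
(`tsum_mul_convolution_indicator_div_eq_sum` with `a = b∗ν₁*`, finitely supported). The node is typed
with the printed χ-free `b`; the identity is true as typed (the χ-reading twin is the instance
`f = bχ` of the same generic theorem, sibling file).
[cite: Zhang2022LandauSiegel, §17 p.98] -/
theorem step17_u019_holds (hD : 3 ≤ ell D) : Step17_u019 c' χ := by
  obtain ⟨N, hb, -, hν⟩ := exists_common_support c' χ hD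
  unfold Step17_u019 varrho17
  exact tsum_mul_convolution_indicator_div_eq_sum (bConvNuOne c' χ) (nu χ) (kappa2bar c' D) (D ^ 4)
    (M := N * N) (fun n hn => convolution_eq_zero_of_le hb hν hn)

/-- **`Z22:§17.u020` (literal) holds** for every modulus with `𝓛 ≥ 3`: for `l ≥ 1`,
`Σ_m (b∗ν₁*)(lm)κ̄₂(m)/m = Σ_{l=l₁l₂} Σ_{m₁} Σ_{(m₂,l₁)=1} b(l₁m₁)ν₁*(l₂m₂)κ̄₂(m₁m₂)/(m₁m₂)`
(`tsum_convolution_mul_div_eq_sum_divisorsAntidiagonal`). True as typed (χ-free `b`); the χ-reading twin is the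
instance `f = bχ` of the same generic theorem (sibling file). [cite: Zhang2022LandauSiegel, §17 p.98] -/
theorem step17_u020_holds (hD : 3 ≤ ell D) : Step17_u020 c' χ := by
  obtain ⟨N, hb, -, hν⟩ := exists_common_support c' χ hD
  intro l hl
  exact tsum_convolution_mul_div_eq_sum_divisorsAntidiagonal (bcoef D) (nuOneStar c' χ)
    (kappa2bar c' D) hb hν hl

end Instances

end Literature.NumberTheory.LFunctions.Zhang2022.Typed.Section17
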